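import Mathlib.Analysis.SpecialFunctions.Stirling
import Mathlib.Analysis.Complex.ExponentialBounds
import Mathlib.Analysis.SpecialFunctions.Pow.Real
import Mathlib.Analysis.SpecialFunctions.Sqrt
import Mathlib.Analysis.SpecialFunctions.Log.Basic
import Mathlib.Data.Fintype.Perm
import Mathlib.Data.Fintype.BigOperators
import Literature.Barriers.MatrixMultiplication.YoungSubgroupBarrier
import HarnessLib

/-!
# Counting lemmas for three Young subgroups of `Sₙ` (towards BCCGU 2017, Thm. 4.2)

Topic `Literature/Barriers/MatrixMultiplication`; companion of `YoungSubgroupBarrier.lean`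
(Blasiak–Church–Cohn–Grochow–Umans 2017, arXiv:1712.02302, §4, Thm. 4.2: for Young subgroups
`H₁, H₂, H₃ ≤ Sₙ` with pairwise trivial intersections, `|Sₙ|/(|H₁||H₂||H₃|)^{2/3} ≥ e^{cn − d√n log n}`).
This file collects the elementary ingredients of a proof of Thm. 4.2 (assembled in
`YoungSubgroupBarrierProofs.lean`); the proof formalised there is NOT the printed induction on the
largest part (BCCGU §4, with Lemma 4.3) but a direct double-counting/convexity argument, whose
ingredients are:

* `(univ.filter fun y => f y = f x).card` — the size of the block of `x` in the partition of `[n]` defined by the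
  labelling `f : Fin n → ℕ` (the Young subgroup `youngSubgroup f` is `∏_b S_{f⁻¹(b)}`);
* `card_youngSubgroup_le` — `|youngSubgroup f| ≤ ∏_b |f⁻¹(b)|!` (restriction to the fibres is
  injective), and its per-element logarithmic form `log_card_youngSubgroup_le`:
  `log |H| ≤ ∑_x log(a_f(x)!)/a_f(x)`;
* `eq_of_inf_eq_bot` — if `youngSubgroup f ⊓ youngSubgroup g = ⊥` then two points in a common
  `f`-block and a common `g`-block coincide (the transposition would lie in both subgroups), and
  the resulting **incidence bound** `sum_card_block_mul_le`: `∑_x a_f(x) a_g(x) ≤ n²`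
  (the map `(x, y, z) ↦ (y, z)` on triples with `y ∼_f x`, `z ∼_g x` is injective);
* Stirling in logarithmic form from Mathlib's `Stirling` file: `log_factorial_le`
  (`log n! ≤ n log n − n + ½ log n + 1`, from the monotonicity of the Stirling sequence) and
  `sub_le_log_factorial` (`n log n − n ≤ log n!`), whence the per-element cost bound
  `log_factorial_div_le`: `log(a!)/a ≤ log a − 1 + (1 + log a)/a`;
* the three-variable inequality `three_var_le` behind the Lagrangian step: for reals
  `a, b, c ≥ 1` and `log n ≥ 14`,
  `∑ (log aᵢ − 1 + (1 + log aᵢ)/aᵢ) − (ab + bc + ac)/(2n) ≤ (3/2) log n − 33/10`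
  (tangent-line bound `xy ≥ m(1 + log x + log y − log m)` = `add_one_le_exp`, and a case
  distinction on whether all `log aᵢ ≥ 4`).

All statements here are proved; the file contains no definitions and no named facts.

## Audit 2026-08-17 (D-0021 barrier audit of this ingredient file; docstring addition only, statements unchanged)

CONFIRMED. (1) Every declaration below is a kernel-checked theorem (axioms `propext`,
`Classical.choice`, `Quot.sound`); there is no named fact in this file to narrow or refute, and
`YoungSubgroupBarrierProofs.lean` assembles exactly these lemmas into `BCCGU2017_thm42_holds`
(`c = 1/5`, `d = 3e⁷`). The quotation of Thm. 4.2 was re-checked on the held text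
(`paper:arxiv-1712.02302`, chunk 9: "Let `H₁, H₂, H₃ ⊆ Sₙ` be Young subgroups such that
`H₁ ∩ H₂ = H₂ ∩ H₃ = H₁ ∩ H₃ = {1}`. There exists universal constants `c, d > 0` for which
`|Sₙ|/(|H₁||H₂||H₃|)^{2/3} ≥ e^{cn − d√n log n}`"); in the printed induction (chunk 10) the
small-part threshold is `t < e^{0.49}√n` — "`|Hᵢ| ≤ ((e^{0.49}√n)!)^{√n/e^{0.49}} = n^{O(√n)} n^{n/2}/e^{0.51n}`"
pins it — not `e^{0.49√n}`.
(2) What the ingredients use. The only structural input is `eq_of_inf_eq_bot`: for partition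
stabilisers, trivial pairwise intersection is EQUIVALENT to pairwise orthogonality of the
partitions (an `f`-block and a `g`-block meet in at most one point), because `youngSubgroup f`
contains the transposition of any two points of a block; the triple product property is never
used (as in print, chunk 9: "using only the fact that the three Young subgroups must have trivial
pairwise intersections"). Both uses of "Young" are load-bearing — the order bound
`|H| ≤ ∏_b m_b!` needs `H ≤ youngSubgroup f`, the incidence bound needs `H ⊇` the in-block
transpositions — and neither transfers to general subgroups: every `H ≤ Sₙ` lies in the Young
subgroup of its orbit partition, but the orbit partitions of trivially-intersecting subgroups
need not be orthogonal (two cyclic groups generated by `n`-cycles with no common non-trivial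
power are both transitive), and large transitive proper subgroups exist (`S_{n/2} ≀ S₂`, of order
`n!/2^{n+o(n)}`). So nothing in this file bears on the open extension to all subgroup or
subset triples of `Sₙ` ("A smaller step in the direction of ruling out `ω = 2` in the symmetric
group would be to extend our result to all triples of subgroups (not just Young subgroups)",
§5), and the scope is exactly `scope_caveats` (a) of `YoungSubgroupBarrier`.
(3) Sharpness of the method (remark; only the `c = 1/5` version is formalised). The supremum over
`a, b, c ≥ 1` of the left side of `three_var_le` is `(3/2) log n − 9/2 + o(1)`, attained near
`a = b = c = √n` (numerically `16.52` against the proved bound `17.7` at `log n = 14`), so the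
same assembly proves Thm. 4.2 with every constant `c < 1` (`d = d(c)`); conversely the three
parallel classes of slopes `0, ∞, 1` in `ℤ_q × ℤ_q` (`n = q²`; pairwise orthogonal, not TPP) have
`log(n!/P^{2/3}) = n + O(√n log n)`, `P = |H₁||H₂||H₃| = (q!)^{3q}` (for non-square `n` pad
`ℤ_q²`, `q = ⌊√n⌋`, with `n − q² ≤ 2√n` common singleton blocks: still pairwise orthogonal, same
`P`, and `log n!` grows by `≤ 2√n log n`). Under the pairwise-trivial hypothesis alone the exact
rate is therefore `e^{(1+o(1))n}`; the TPP shapes of BCCGU §4 sit at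
`(2 − log 2)n ≈ 1.307n` (triangle) and `(2 + log 3 − (8/3) log 2)n ≈ 1.250n` (hexagon). Either way
the deficit `e^{Θ(n)}` exceeds the class number `p(n) = e^{O(√n)}` exponentially: the barrier is
not marginal, and an evasion inside `Sₙ` needs sets of size `(n!)^{1/2} e^{−o(√n)}` that are not
partition stabilisers (BCCGU §5).
(4) Literature 2017–2026 (searched 2026-08-17: forward citations of arXiv:1712.02302; arXiv,
Crossref, the held corpus and the galaxy corpora for "triple product property" with
symmetric / Young / subgroup; OpenAlex and Semantic Scholar were rate-limited that day): no
extension of Thm. 4.2 beyond Young subgroups and no TPP construction in `Sₙ` or `Aₙ` outside Young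
subgroups has appeared (cf. `YoungSubgroupBarrier`, evasions_known (iii)); the nearest item,
I. Hedtke, *Upgrading subgroup triple-product-property triples* (arXiv:1107.5973, 2011/2015),
enlarges subgroup TPP triples to subset triples heuristically in groups of small order only.

## References

* J. Blasiak, T. Church, H. Cohn, J. A. Grochow, C. Umans, *Which groups are amenable to proving
  exponent two for matrix multiplication?*, arXiv:1712.02302 (2017), §4, Thm. 4.2
  (`BlasiakChurchCohnGrochowUmans2017`).
* Mathlib `Mathlib.Analysis.SpecialFunctions.Stirling` (`Stirling.log_stirlingSeq'_antitone`,
  `Stirling.le_log_factorial_stirling`).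
-/

noncomputable section

open Finset Real

namespace Literature.Barriers.MatrixMultiplication

/-! ### Stirling's formula, logarithmic bounds -/

section StirlingBounds

/-- **Upper Stirling bound**: `log n! ≤ n log n − n + ½ log n + 1` for `n ≥ 1`, i.e.
`n! ≤ e √n (n/e)ⁿ`, from the monotonicity of the Stirling sequence `n!/(√(2n)(n/e)ⁿ)`
(Mathlib `Stirling.log_stirlingSeq'_antitone`) and its value `e/√2` at `n = 1`. [folklore] -/
theorem log_factorial_le {n : ℕ} (hn : n ≠ 0) :
    Real.log (n.factorial) ≤ n * Real.log n - n + Real.log n / 2 + 1 := by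
  obtain ⟨m, rfl⟩ := Nat.exists_eq_succ_of_ne_zero hn
  have hanti := Stirling.log_stirlingSeq'_antitone (Nat.zero_le m)
  simp only [Function.comp_apply, Nat.succ_eq_add_one, Nat.zero_add] at hanti
  rw [Stirling.log_stirlingSeq_formula, Stirling.log_stirlingSeq_formula, Nat.factorial_one] at hanti
  have hm : (0 : ℝ) < (m + 1 : ℕ) := by positivity
  rw [Real.log_div (ne_of_gt hm) (Real.exp_pos 1).ne', Real.log_exp,
    Real.log_mul two_ne_zero (ne_of_gt hm)] at hanti
  simp only [Nat.cast_one, Real.log_one, mul_one, one_mul] at hanti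
  rw [Real.log_div one_ne_zero (Real.exp_pos 1).ne', Real.log_exp, Real.log_one] at hanti
  push_cast at hanti ⊢
  nlinarith [hanti]

/-- **Lower Stirling bound**: `n log n − n ≤ log n!` (Mathlib `Stirling.le_log_factorial_stirling`,
dropping the non-negative terms `½ log n + ½ log 2π`). [folklore] -/
theorem sub_le_log_factorial (n : ℕ) :
    n * Real.log n - n ≤ Real.log (n.factorial) := by
  rcases Nat.eq_zero_or_pos n with rfl | hn
  · simp
  have h := Stirling.le_log_factorial_stirling hn.ne'
  have h1 : 0 ≤ Real.log n := Real.log_nonneg (by exact_mod_cast hn)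
  have h2 : 0 ≤ Real.log (2 * Real.pi) := Real.log_nonneg (by linarith [Real.two_le_pi])
  linarith

/-- `log n! ≤ n log n` (from `log_factorial_le` and `log n ≤ n − 1`). [folklore] -/
theorem log_factorial_le_mul_log (n : ℕ) : Real.log (n.factorial) ≤ n * Real.log n := by
  rcases Nat.eq_zero_or_pos n with rfl | hn
  · simp
  have h := log_factorial_le hn.ne'
  have h1 : Real.log n ≤ n - 1 := Real.log_le_sub_one_of_pos (by exact_mod_cast hn)
  have h2 : (1 : ℝ) ≤ n := by exact_mod_cast hn
  linarith

/-- **Per-element cost of a block of size `a`**: `log(a!)/a ≤ log a − 1 + (1 + log a)/a` for an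
integer `a ≥ 1` (from `log_factorial_le`). [folklore] -/
theorem log_factorial_div_le {a : ℕ} (ha : 1 ≤ a) :
    Real.log (a.factorial) / a ≤ Real.log a - 1 + (1 + Real.log a) / a := by
  have ha0 : (0 : ℝ) < a := by exact_mod_cast ha
  have h := log_factorial_le (n := a) (by omega)
  have hlog : 0 ≤ Real.log a := Real.log_nonneg (by exact_mod_cast ha)
  rw [div_le_iff₀ ha0]
  have e : (Real.log a - 1 + (1 + Real.log a) / a) * a = a * Real.log a - a + (1 + Real.log a) := by
    field_simp
  rw [e]
  linarith

end StirlingBounds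

/-! ### The three-variable inequality -/

section ThreeVar

/-- `log a − 1 + (1 + log a)/a ≤ log a` for `a ≥ 1` (i.e. `1 + log a ≤ a`). [folklore] -/
theorem cost_le_log {a : ℝ} (ha : 1 ≤ a) :
    Real.log a - 1 + (1 + Real.log a) / a ≤ Real.log a := by
  have h := Real.log_le_sub_one_of_pos (by linarith : (0:ℝ) < a)
  have : (1 + Real.log a) / a ≤ 1 := by
    rw [div_le_one (by linarith)]; linarith
  linarith

/-- The correction term is small on large blocks: `(1 + log a)/a ≤ 2/e²` when `log a ≥ 4`
(via `log a = 2 log √a ≤ 2(√a − 1)` and `√a ≥ e²`). [folklore] -/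
theorem corr_le {a : ℝ} (ha : 1 ≤ a) (ha4 : 4 ≤ Real.log a) :
    (1 + Real.log a) / a ≤ 2 / Real.exp 2 := by
  have ha0 : 0 < a := by linarith
  set s := Real.sqrt a with hs
  have hs0 : 0 < s := Real.sqrt_pos.2 ha0
  have hsa : s ^ 2 = a := Real.sq_sqrt ha0.le
  have hlog : Real.log a = 2 * Real.log s := by
    rw [← hsa, Real.log_pow]; norm_num
  have hls : Real.log s ≤ s - 1 := Real.log_le_sub_one_of_pos hs0
  have hea : Real.exp 4 ≤ a := by
    have := Real.exp_le_exp.2 ha4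
    rwa [Real.exp_log ha0] at this
  have hes : Real.exp 2 ≤ s := by
    have h4 : Real.exp 4 = (Real.exp 2) ^ 2 := by
      rw [← Real.exp_nat_mul]; norm_num
    rw [h4, ← hsa] at hea
    exact (pow_le_pow_iff_left₀ (Real.exp_pos 2).le hs0.le two_ne_zero).1 hea
  calc (1 + Real.log a) / a ≤ 2 / s := by
        rw [div_le_div_iff₀ ha0 hs0, hlog]
        nlinarith
    _ ≤ 2 / Real.exp 2 := div_le_div_of_nonneg_left (by norm_num) (Real.exp_pos 2) hes

/-- **Tangent-line bound** for a product: `m (1 + log x + log y − log m) ≤ x y` for positive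
reals (`1 + u ≤ eᵘ` at `u = log(xy/m)`). [folklore] -/
theorem mul_ge_tangent {x y m : ℝ} (hx : 0 < x) (hy : 0 < y) (hm : 0 < m) :
    m * (1 + Real.log x + Real.log y - Real.log m) ≤ x * y := by
  have h := Real.add_one_le_exp (Real.log x + Real.log y - Real.log m)
  rw [Real.exp_sub, Real.exp_add, Real.exp_log hx, Real.exp_log hy, Real.exp_log hm,
    le_div_iff₀ hm] at h
  linarith

/-- Case "all blocks large" of `three_var_le`: if `log a, log b, log c ≥ 4` then
`∑ costs − (ab + bc + ac)/(2n) ≤ (3/2) log n − 9/2 + 3·(2/e²)` (tangent-line bound for each of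
the three products at the base point `n`). [folklore] -/
theorem three_var_case_large {n a b c : ℝ} (hn : 0 < n) (ha : 1 ≤ a) (hb : 1 ≤ b) (hc : 1 ≤ c)
    (ha4 : 4 ≤ Real.log a) (hb4 : 4 ≤ Real.log b) (hc4 : 4 ≤ Real.log c) :
    Real.log a - 1 + (1 + Real.log a) / a + (Real.log b - 1 + (1 + Real.log b) / b) +
        (Real.log c - 1 + (1 + Real.log c) / c) - (a * b + b * c + a * c) / (2 * n) ≤
      3 / 2 * Real.log n - 9 / 2 + 3 * (2 / Real.exp 2) := by
  have hab := mul_ge_tangent (by linarith : (0:ℝ) < a) (by linarith : (0:ℝ) < b) hn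
  have hbc := mul_ge_tangent (by linarith : (0:ℝ) < b) (by linarith : (0:ℝ) < c) hn
  have hac := mul_ge_tangent (by linarith : (0:ℝ) < a) (by linarith : (0:ℝ) < c) hn
  have ca := corr_le ha ha4
  have cb := corr_le hb hb4
  have cc := corr_le hc hc4
  have hsum : (3 + 2 * (Real.log a + Real.log b + Real.log c) - 3 * Real.log n) / 2 ≤
      (a * b + b * c + a * c) / (2 * n) := by
    rw [div_le_div_iff₀ (by norm_num : (0:ℝ) < 2) (by linarith : (0:ℝ) < 2 * n)]
    nlinarith
  linarith

/-- Case "some block small" of `three_var_le`: if `log a ≤ 4` then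
`∑ costs − (ab + bc + ac)/(2n) ≤ log n + 3 + log 2` (drop the penalties involving `a`, bound the
costs by `log`, and use the tangent-line bound for `bc` at the base point `2n`). [folklore] -/
theorem three_var_case_small {n a b c : ℝ} (hn : 0 < n) (ha : 1 ≤ a) (hb : 1 ≤ b) (hc : 1 ≤ c)
    (ha4 : Real.log a ≤ 4) :
    Real.log a - 1 + (1 + Real.log a) / a + (Real.log b - 1 + (1 + Real.log b) / b) +
        (Real.log c - 1 + (1 + Real.log c) / c) - (a * b + b * c + a * c) / (2 * n) ≤
      Real.log n + 3 + Real.log 2 := by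
  have hbc := mul_ge_tangent (by linarith : (0:ℝ) < b) (by linarith : (0:ℝ) < c)
    (by linarith : (0:ℝ) < 2 * n)
  rw [Real.log_mul two_ne_zero hn.ne'] at hbc
  have ga := cost_le_log ha
  have gb := cost_le_log hb
  have gc := cost_le_log hc
  have hdrop : b * c / (2 * n) ≤ (a * b + b * c + a * c) / (2 * n) := by
    apply div_le_div_of_nonneg_right _ (by linarith : (0:ℝ) ≤ 2 * n)
    nlinarith
  have hpen : 1 + Real.log b + Real.log c - (Real.log 2 + Real.log n) ≤ b * c / (2 * n) := by
    rw [le_div_iff₀ (by linarith : (0:ℝ) < 2 * n)]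
    linarith
  linarith

/-- **The three-variable inequality** (pointwise Lagrangian step of the proof of BCCGU Thm. 4.2
in `YoungSubgroupBarrierProofs`): for reals `a, b, c ≥ 1` and `log n ≥ 14`,
`∑ᵢ (log aᵢ − 1 + (1 + log aᵢ)/aᵢ) − (ab + bc + ac)/(2n) ≤ (3/2) log n − 33/10`.
The maximum is attained near `a = b = c = √n` (value `(3/2) log n − 9/2 + o(1)`); on the
boundary (some `aᵢ` bounded) the expression is only `log n + O(1)`. [folklore] -/
theorem three_var_le {n a b c : ℝ} (hn : 0 < n) (hn14 : 14 ≤ Real.log n) (ha : 1 ≤ a)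
    (hb : 1 ≤ b) (hc : 1 ≤ c) :
    Real.log a - 1 + (1 + Real.log a) / a + (Real.log b - 1 + (1 + Real.log b) / b) +
        (Real.log c - 1 + (1 + Real.log c) / c) - (a * b + b * c + a * c) / (2 * n) ≤
      3 / 2 * Real.log n - 33 / 10 := by
  have hl2 := Real.log_two_lt_d9
  have he : 2 / Real.exp 2 ≤ 2 / 5 := by
    apply div_le_div_of_nonneg_left (by norm_num) (by norm_num)
    have h1 := Real.exp_one_gt_d9
    have : Real.exp 2 = Real.exp 1 * Real.exp 1 := by rw [← Real.exp_add]; norm_num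
    nlinarith
  by_cases ha4 : 4 ≤ Real.log a
  · by_cases hb4 : 4 ≤ Real.log b
    · by_cases hc4 : 4 ≤ Real.log c
      · linarith [three_var_case_large hn ha hb hc ha4 hb4 hc4]
      · have h := three_var_case_small hn hc ha hb (le_of_not_ge hc4)
        have e : c * a + a * b + c * b = a * b + b * c + a * c := by ring
        rw [e] at h
        linarith
    · have h := three_var_case_small hn hb ha hc (le_of_not_ge hb4)
      have e : b * a + a * c + b * c = a * b + b * c + a * c := by ring
      rw [e] at h
      linarith
  · linarith [three_var_case_small hn ha hb hc (le_of_not_ge ha4)]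

end ThreeVar

/-! ### Young subgroups: block sizes, the order bound, the incidence bound -/

section Young

variable {n : ℕ}

/-- Every block contains its point: the block `{y | f y = f x}` of `x` has size `≥ 1`.
(Throughout, the size of the block of `x` in the partition of `[n]` into the fibres of
`f : Fin n → ℕ` is written `(univ.filter fun y => f y = f x).card`.) [folklore] -/
theorem one_le_card_block (f : Fin n → ℕ) (x : Fin n) :
    1 ≤ (univ.filter fun y => f y = f x).card :=
  Finset.card_pos.2 ⟨x, by simp⟩

/-- A transposition of two points with the same label lies in the Young subgroup. [folklore] -/
theorem swap_mem_youngSubgroup {α : Type*} {f : Fin n → α} {x y : Fin n} (h : f x = f y) :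
    Equiv.swap x y ∈ youngSubgroup f := by
  rw [mem_youngSubgroup]
  intro z
  rcases eq_or_ne z x with rfl | hzx
  · rw [Equiv.swap_apply_left]; exact h.symm
  rcases eq_or_ne z y with rfl | hzy
  · rw [Equiv.swap_apply_right]; exact h
  rw [Equiv.swap_apply_of_ne_of_ne hzx hzy]

/-- **Trivially intersecting Young subgroups separate points**: if
`youngSubgroup f ⊓ youngSubgroup g = ⊥`, two points in a common `f`-block and a common `g`-block
are equal (else their transposition is a non-trivial element of both subgroups); equivalently, an
`f`-block and a `g`-block meet in at most one point. [cite: BlasiakChurchCohnGrochowUmans2017, §4] -/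
theorem eq_of_inf_eq_bot {f g : Fin n → ℕ} (h : youngSubgroup f ⊓ youngSubgroup g = ⊥)
    {x y : Fin n} (hf : f x = f y) (hg : g x = g y) : x = y := by
  have hmem : Equiv.swap x y ∈ youngSubgroup f ⊓ youngSubgroup g :=
    Subgroup.mem_inf.2 ⟨swap_mem_youngSubgroup hf, swap_mem_youngSubgroup hg⟩
  rw [h, Subgroup.mem_bot] at hmem
  exact Equiv.swap_eq_one_iff.1 hmem

/-- **Incidence bound**: if `youngSubgroup f ⊓ youngSubgroup g = ⊥` then
`∑_x a_f(x) · a_g(x) ≤ n²`, where `aₕ(x)` is the size of the `h`-block of `x`: the left-hand side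
counts the triples `(x, y, z)` with `y ∼_f x`, `z ∼_g x`, and `(x, y, z) ↦ (y, z)` is injective by
`eq_of_inf_eq_bot`. [folklore] -/
theorem sum_card_block_mul_le {f g : Fin n → ℕ} (h : youngSubgroup f ⊓ youngSubgroup g = ⊥) :
    ∑ x, (univ.filter fun y => f y = f x).card * (univ.filter fun y => g y = g x).card ≤ n ^ 2 := by
  have hs : ∑ x, (univ.filter fun y => f y = f x).card * (univ.filter fun y => g y = g x).card =
      (univ.sigma fun x : Fin n =>
        (univ.filter fun y => f y = f x) ×ˢ (univ.filter fun z => g z = g x)).card := by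
    rw [Finset.card_sigma]
    simp only [Finset.card_product]
  rw [hs]
  calc _ ≤ ((univ : Finset (Fin n)) ×ˢ (univ : Finset (Fin n))).card := by
        refine Finset.card_le_card_of_injOn (fun p => p.2)
          (fun p _ => Finset.mem_coe.2 (Finset.mem_product.2 ⟨Finset.mem_univ _, Finset.mem_univ _⟩))
          ?_
        rintro ⟨x, y, z⟩ hx ⟨x', y', z'⟩ hx' heq
        simp only [Finset.mem_coe, Finset.mem_sigma, Finset.mem_product, Finset.mem_filter,
          Finset.mem_univ, true_and] at hx hx'
        simp only [Prod.mk.injEq] at heq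
        obtain ⟨rfl, rfl⟩ := heq
        obtain rfl : x = x' := eq_of_inf_eq_bot h (hx.1.symm.trans hx'.1) (hx.2.symm.trans hx'.2)
        rfl
    _ = n ^ 2 := by simp [sq]

/-- **Order bound for a Young subgroup**: `|youngSubgroup f| ≤ ∏_{b ∈ im f} |f⁻¹(b)|!`
(restricting a fibre-preserving permutation to the fibres is injective into
`∏_b Perm(f⁻¹(b))`; in fact an isomorphism `youngSubgroup f ≅ ∏_b S_{f⁻¹(b)}`, BCCGU §4: "every
Young subgroup of `Sₙ` is isomorphic to `S_{n₁} × ⋯ × S_{n_k}`" — only the inequality is needed).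
[cite: BlasiakChurchCohnGrochowUmans2017, §4] -/
theorem card_youngSubgroup_le (f : Fin n → ℕ) :
    Nat.card (youngSubgroup f) ≤
      ∏ b ∈ univ.image f, ((univ.filter fun y => f y = b).card).factorial := by
  classical
  let φ : youngSubgroup f → (∀ b : (univ.image f), Equiv.Perm {y : Fin n // f y = b}) :=
    fun σ b => (σ : Equiv.Perm (Fin n)).subtypePerm
      (fun y => by rw [mem_youngSubgroup.1 σ.2 y])
  have hφ : Function.Injective φ := by
    intro σ τ hστ
    apply Subtype.ext
    apply Equiv.ext
    intro y
    have := Equiv.congr_fun (congr_fun hστ ⟨f y, mem_image_of_mem f (mem_univ y)⟩) ⟨y, rfl⟩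
    exact congrArg Subtype.val this
  calc Nat.card (youngSubgroup f)
        ≤ Nat.card (∀ b : (univ.image f), Equiv.Perm {y : Fin n // f y = b}) :=
          Nat.card_le_card_of_injective φ hφ
    _ = ∏ b ∈ univ.image f, ((univ.filter fun y => f y = b).card).factorial := by
          rw [Nat.card_eq_fintype_card, Fintype.card_pi, ← Finset.prod_coe_sort (univ.image f)]
          refine Finset.prod_congr rfl fun b _ => ?_
          rw [Fintype.card_perm, Fintype.card_subtype]

/-- **Per-element form of the order bound**: `log |youngSubgroup f| ≤ ∑_x log(a(x)!)/a(x)` with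
`a(x)` the size of the block of `x` (`log ∏_b m_b! = ∑_b ∑_{x ∈ f⁻¹(b)} log(m_b!)/m_b`). [folklore] -/
theorem log_card_youngSubgroup_le (f : Fin n → ℕ) :
    Real.log (Nat.card (youngSubgroup f)) ≤
      ∑ x, Real.log (((univ.filter fun y => f y = f x).card).factorial) / ((univ.filter fun y => f y = f x).card) := by
  classical
  set m : ℕ → ℕ := fun b => (univ.filter fun y => f y = b).card with hm
  set F : ℕ → ℝ := fun b => Real.log ((m b).factorial) / (m b) with hF
  have hpos : 0 < Nat.card (youngSubgroup f) := Nat.card_pos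
  have h1 := card_youngSubgroup_le f
  have h2 : Real.log (Nat.card (youngSubgroup f)) ≤
      Real.log ((∏ b ∈ univ.image f, (m b).factorial : ℕ) : ℝ) :=
    Real.log_le_log (by exact_mod_cast hpos) (by exact_mod_cast h1)
  refine h2.trans (le_of_eq ?_)
  push_cast
  rw [Real.log_prod (s := univ.image f) (fun b _ => by positivity)]
  have hrhs : ∑ x, Real.log (((univ.filter fun y => f y = f x).card).factorial) / ((univ.filter fun y => f y = f x).card) = ∑ x, F (f x) := rfl
  rw [hrhs, ← Finset.sum_fiberwise_of_maps_to' (g := f) (t := univ.image f)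
    (fun x _ => mem_image_of_mem f (mem_univ x)) F]
  refine Finset.sum_congr rfl fun b hb => ?_
  rw [Finset.sum_const, nsmul_eq_mul]
  have hmb : (m b : ℝ) ≠ 0 := by
    obtain ⟨x, _, rfl⟩ := mem_image.1 hb
    exact_mod_cast (Finset.card_pos.2 ⟨x, by simp⟩).ne'
  show _ = (m b : ℝ) * F b
  simp only [hF]
  field_simp

/-- `|youngSubgroup f| ≤ |Sₙ| = n!`, in logarithmic form. [folklore] -/
theorem log_card_youngSubgroup_le_log_factorial (f : Fin n → ℕ) :
    Real.log (Nat.card (youngSubgroup f)) ≤ Real.log (n.factorial) := by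
  have h : Nat.card (youngSubgroup f) ≤ n.factorial := by
    have := Subgroup.card_le_card_group (youngSubgroup f)
    rwa [Nat.card_eq_fintype_card (α := Equiv.Perm (Fin n)), Fintype.card_perm,
      Fintype.card_fin] at this
  exact Real.log_le_log (by exact_mod_cast Nat.card_pos) (by exact_mod_cast h)

end Young

end Literature.Barriers.MatrixMultiplication

end
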